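import Summits.QuantumFields.BalabanUV.Beta.GAN24.BornLambdaUndressedRow
import Summits.QuantumFields.BalabanUV.Beta.GAN24.TaylorRowLamAt
import Summits.QuantumFields.BalabanUV.Beta.GAN24.TaylorRowLamTopAt
import Summits.QuantumFields.BalabanUV.Beta.GAN24.S3ShapeL0At

/-!
# GAN24 ∕ BORNSEC, Λ half — `BornLambdaRowHolds`: THE UNDRESSED Λ-LINEAGE LETTER `hUg` OF THE `d = 3` COMB FAMILY, UNCONDITIONALLY

NOT IN PRINT; OUR BOOKKEEPING ([folklore] assembly BY NAME; no estimate of Bałaban's is formalised, cited or discharged here).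
HONEST: `hUg` and `hU` (the undressed Λ row of the comb family (E) = `WardLocusRecursive.SrecAt`, pin `cE = Lc^4`) are now UNCONDITIONAL tree theorems; `hB(0, cΛ)` is
CONDITIONAL on exactly ONE letter, the per-lineage Λ contact letter `hCg` ((C4)–(C6), leaf-02 g49's `BornLambdaContactBound.exists_hCg_three`); hB, hS0 of the comb family,
(hS, hSall) remain OPEN; NEVER «G-an2-4 closed» as (CONV-C); NOT D1, NOT `BetaPertH`, NOT continuum, NOT Clay.

WHAT.  The three rooted road-S3 Λ rows of the owner's W5 package «ROOTED-S3-Λ» are in the tree — (ρ-c) `TaylorRowLamAt.rowL_three_at` (leaf-06 g40), (ρ-d)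
`TaylorRowLamTopAt.rowLamTop_at` (leaf-04 g55) and `S3ShapeL0At.rowL0_holds_at` (leaf-04 g55 ∕ leaf-01 g60) — and dock BY NAME into `BornLambdaUndressedRow.exists_hUg_of_rootedRows`
(the junctions certified by leaf-04 g55's probe J-ρd-1 and ref2 R243∕R245).  This file records the four instances.

Unit `b2b-balaban-gan24-p1` (row owner G-an2-4, gen 21), 2026-08-21.
-/

noncomputable section

open Finset
open scoped BigOperators
open Literature.MathematicalPhysics.QuantumFieldTheory
open Literature.MathematicalPhysics.QuantumFieldTheory.Balaban1983to89
open Literature.MathematicalPhysics.QuantumFieldTheory.Balaban1983to89.Beta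
open OneStepResolventKernel (Fib LocStencil)
open AffineAveraging (box toSite)
open Summit.QuantumFields.BalabanUV.Beta.HessKerDressedUnits (unitS)
open Summit.QuantumFields.BalabanUV.Beta.GAN24.CombesThomas (sfStep smStep)
open BalabanCompositeJets (respStep)
open Summit.QuantumFields.BalabanUV.Beta.GAN24.Push3 (push₃)
open Summit.QuantumFields.BalabanUV.Beta.GAN24.Push4Iter (legChain)
open Summit.QuantumFields.BalabanUV.Beta.GAN24.RespStepBmDecompExact (respStepBmSeq)
open Summit.QuantumFields.BalabanUV.Beta.GAN24.SrecWilsonSector (bornSecAt)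
open Summit.QuantumFields.BalabanUV.Beta.GAN24.SrecBornSector (freshAt)
open Summit.QuantumFields.BalabanUV.Beta.GAN24.BornLambdaUndressedRow (exists_hUg_of_rootedRows exists_hU_of_rootedRows exists_hBLam_of_rootedRows
  exists_hBLam_of_rootedRows_poly)
open Summit.QuantumFields.BalabanUV.Beta.GAN24.TaylorRowLamAt (rowL_three_at)
open Summit.QuantumFields.BalabanUV.Beta.GAN24.TaylorRowLamTopAt (rowLamTop_at)
open Summit.QuantumFields.BalabanUV.Beta.GAN24.S3ShapeL0At (rowL0_holds_at)

namespace Summit.QuantumFields.BalabanUV.Beta.GAN24.BornLambdaRowHolds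

variable {Lc : ℕ} [NeZero Lc]

/-- NOT IN PRINT; OUR BOOKKEEPING ([folklore] assembly; UNCONDITIONAL).  **THE UNDRESSED Λ-LINEAGE LETTER `hUg` OF THE `d = 3` COMB FAMILY HOLDS** at the pin `cE = Lc^4`, every
`Lc ≥ 2`, every `cΛ`, uniformly in the in-block root: per lineage `i < k` the weighted undressed member is a local stencil family with constant `C·(Lc⁻¹)^{k−i}` at one rate
(`exists_hUg_of_rootedRows` with the three rooted rows supplied BY NAME). -/
theorem exists_hUg_three (hLc : 2 ≤ Lc) {cE : ℝ} (hcE : cE = (Lc : ℝ) ^ (3 + 1)) (cΛ : ℝ) :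
    ∃ C θ δ : ℝ, 0 ≤ C ∧ 0 ≤ θ ∧ θ < 1 ∧ 0 < δ ∧ ∀ (rr : Fin (3 + 1) → ℕ), rr ∈ box (3 + 1) Lc → ∀ k i : ℕ, i < k →
      LocStencil (fun κ' u' => (cE * (Lc : ℝ) ^ (2 * (3 + 1))) ^ (k - i) •
        push₃ (respStep (d := 3) (Lc ^ i) (Lc ^ k)) (respStep (d := 3) (Lc ^ i) (Lc ^ k)) (respStep (d := 3) (Lc ^ i) (Lc ^ k))
          (unitS (sfStep Lc i) (smStep 3 Lc i) (freshAt Lc (toSite rr) 0 cΛ i)) κ' u') (C * θ ^ (k - i)) δ :=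
  exists_hUg_of_rootedRows hLc hcE cΛ (rowL_three_at cΛ) (rowLamTop_at (le_trans (by norm_num) hLc) cΛ)
    (rowL0_holds_at (le_trans (by norm_num) hLc) cΛ)

/-- NOT IN PRINT; OUR BOOKKEEPING ([folklore] assembly; UNCONDITIONAL).  **leaf-01's LETTER `hU` (the undressed Λ row, summed over the birth levels) HOLDS.** -/
theorem exists_hU_three (hLc : 2 ≤ Lc) {cE : ℝ} (hcE : cE = (Lc : ℝ) ^ (3 + 1)) (cΛ : ℝ) :
    ∃ C δ : ℝ, 0 < δ ∧ ∀ (rr : Fin (3 + 1) → ℕ), rr ∈ box (3 + 1) Lc → ∀ k : ℕ,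
      LocStencil (∑ i ∈ Finset.range k, fun κ' u' => (cE * (Lc : ℝ) ^ (2 * (3 + 1))) ^ (k - i) •
        push₃ (respStep (d := 3) (Lc ^ i) (Lc ^ k)) (respStep (d := 3) (Lc ^ i) (Lc ^ k)) (respStep (d := 3) (Lc ^ i) (Lc ^ k))
          (unitS (sfStep Lc i) (smStep 3 Lc i) (freshAt Lc (toSite rr) 0 cΛ i)) κ' u') C δ :=
  exists_hU_of_rootedRows hLc hcE cΛ (rowL_three_at cΛ) (rowLamTop_at (le_trans (by norm_num) hLc) cΛ)
    (rowL0_holds_at (le_trans (by norm_num) hLc) cΛ)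

/-- NOT IN PRINT; OUR PROOF ATTEMPT — CONDITIONAL ON ONE LETTER ([folklore] assembly).  **THE Λ-BORN ROW `hB(0, cΛ)` OF THE `d = 3` COMB FAMILY FROM THE CONTACT LETTER ALONE**:
the per-lineage geometric contact letter `hCg` ⇒ `hB(0, cΛ)` (the undressed row is discharged above).  NOT hB (the V half is separate), NOT hS0-comb. -/
theorem exists_hBLam_three_of_contact (hLc : 2 ≤ Lc) {cE : ℝ} (hcE : cE = (Lc : ℝ) ^ (3 + 1)) (cΛ : ℝ)
    (hCg : ∃ C θ δ : ℝ, 0 ≤ C ∧ 0 ≤ θ ∧ θ < 1 ∧ 0 < δ ∧ ∀ (rr : Fin (3 + 1) → ℕ), rr ∈ box (3 + 1) Lc → ∀ k i : ℕ, i < k →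
      LocStencil (fun κ' u' => (cE * (Lc : ℝ) ^ (2 * (3 + 1))) ^ (k - i) •
        (push₃ (legChain (respStepBmSeq (toSite rr) Lc) i (k - 1 - i)) (legChain (respStepBmSeq (toSite rr) Lc) i (k - 1 - i))
            (legChain (respStepBmSeq (toSite rr) Lc) i (k - 1 - i)) (unitS (sfStep Lc i) (smStep 3 Lc i) (freshAt Lc (toSite rr) 0 cΛ i)) κ' u'
          - push₃ (respStep (d := 3) (Lc ^ i) (Lc ^ k)) (respStep (d := 3) (Lc ^ i) (Lc ^ k)) (respStep (d := 3) (Lc ^ i) (Lc ^ k))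
            (unitS (sfStep Lc i) (smStep 3 Lc i) (freshAt Lc (toSite rr) 0 cΛ i)) κ' u')) (C * θ ^ (k - i)) δ) :
    ∃ C δ : ℝ, 0 < δ ∧ ∀ (rr : Fin (3 + 1) → ℕ), rr ∈ box (3 + 1) Lc →
      ∀ k : ℕ, LocStencil (unitS (sfStep Lc k) (smStep 3 Lc k) (bornSecAt Lc (toSite rr) cE 0 cΛ k)) C δ :=
  exists_hBLam_of_rootedRows hLc hcE cΛ (rowL_three_at cΛ) (rowLamTop_at (le_trans (by norm_num) hLc) cΛ)
    (rowL0_holds_at (le_trans (by norm_num) hLc) cΛ) hCg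

/-- NOT IN PRINT; OUR PROOF ATTEMPT — CONDITIONAL ON ONE LETTER ([folklore] assembly).  The same with the POLY-GEOMETRIC contact letter `C·(k−i)^p·θ^{k−i}` (the (C4)∕(C6)
END currency of leaf-02 g49's `BornLambdaContactBound.exists_hCg_three`, `p = 1`). -/
theorem exists_hBLam_three_of_contact_poly (hLc : 2 ≤ Lc) {cE : ℝ} (hcE : cE = (Lc : ℝ) ^ (3 + 1)) (cΛ : ℝ) (p : ℕ)
    (hCg : ∃ C θ δ : ℝ, 0 ≤ C ∧ 0 ≤ θ ∧ θ < 1 ∧ 0 < δ ∧ ∀ (rr : Fin (3 + 1) → ℕ), rr ∈ box (3 + 1) Lc → ∀ k i : ℕ, i < k →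
      LocStencil (fun κ' u' => (cE * (Lc : ℝ) ^ (2 * (3 + 1))) ^ (k - i) •
        (push₃ (legChain (respStepBmSeq (toSite rr) Lc) i (k - 1 - i)) (legChain (respStepBmSeq (toSite rr) Lc) i (k - 1 - i))
            (legChain (respStepBmSeq (toSite rr) Lc) i (k - 1 - i)) (unitS (sfStep Lc i) (smStep 3 Lc i) (freshAt Lc (toSite rr) 0 cΛ i)) κ' u'
          - push₃ (respStep (d := 3) (Lc ^ i) (Lc ^ k)) (respStep (d := 3) (Lc ^ i) (Lc ^ k)) (respStep (d := 3) (Lc ^ i) (Lc ^ k))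
            (unitS (sfStep Lc i) (smStep 3 Lc i) (freshAt Lc (toSite rr) 0 cΛ i)) κ' u')) (C * (((k - i : ℕ) : ℝ) ^ p * θ ^ (k - i))) δ) :
    ∃ C δ : ℝ, 0 < δ ∧ ∀ (rr : Fin (3 + 1) → ℕ), rr ∈ box (3 + 1) Lc →
      ∀ k : ℕ, LocStencil (unitS (sfStep Lc k) (smStep 3 Lc k) (bornSecAt Lc (toSite rr) cE 0 cΛ k)) C δ :=
  exists_hBLam_of_rootedRows_poly hLc hcE cΛ p (rowL_three_at cΛ) (rowLamTop_at (le_trans (by norm_num) hLc) cΛ)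
    (rowL0_holds_at (le_trans (by norm_num) hLc) cΛ) hCg

end Summit.QuantumFields.BalabanUV.Beta.GAN24.BornLambdaRowHolds

end
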